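import Literature.Barriers.HubbardSuperconductivity.SignProblemNPHard
import Literature.Computability.Complexity.CNF
import HarnessLib

/-!
# A direct gadget reduction: CNF satisfiability ↦ Ising ground states with couplings `{0, ±1}`

Support file for the discharge of the barrier `SignProblemNPHard` (Troyer–Wiese 2005,
`SignProblemNPHard.lean`). Troyer–Wiese reduce the `NP`-complete question "is there a spin
configuration of energy `≤ E₀`?" for an Ising spin glass `H = -Σ J_{jk} σ_j σ_k`,
`J_{jk} ∈ {0, ±J}` [cite: TroyerWiese2005, Letter p. 4] (NP-completeness after Barahona,
[cite: Barahona1982, §4.2, Theorem (P3 is NP-hard)]) to the evaluation of a thermal energy. The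
tree's proved source of `NP`-hardness is the Cook–Levin theorem
(`Literature.Computability.Complexity.SAT_isNPHard_holds`), so the Lean proof of the barrier needs a
Karp reduction from CNF satisfiability to Ising ground states with unit couplings on an arbitrary
interaction graph (the generality of `Literature.Barriers.HubbardSuperconductivity.ISINGGROUND`).
This file provides the combinatorial half of such a reduction — an elementary clause-chain gadget,
stated and proved here in full (folklore-level; it is *not* Barahona's planar/two-level
construction, which is not needed for matrices of couplings):

* **Tokens.** A CNF `φ` is flattened into its literal occurrences `T = tokens φ`
  (`Token`: variable, polarity, "opens a clause"); `L = |T|`.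
* **Spins.** `2L + 1` spins: a reference spin `r` (index `0`), and for every token `p` a copy
  spin `c_p` (index `2p+1`, meant to be `+r` iff literal `p` is true) and an auxiliary spin `y_p`
  (index `2p+2`, meant to be the disjunction of the literals from `p` to the end of its clause);
  `ent : Fin (2L+1) ≃ Option (Fin L × Bool)`.
* **Couplings** (`coupling`, `J`; energy `E(σ) = -Σ_{i<j} J_{ij} s_i s_j` as in
  `isingEnergy`): `(c_p, c_q) = ±1` for two occurrences of the same variable (`+1` for equal
  polarities: consistency), `(c_p, y_p) = +1`, and inside a clause `(c_p, y_{p+1}) = -1`,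
  `(y_p, y_{p+1}) = +1` (with `(c_p, y_p)` these form a *frustrated triangle* whose energy is
  `-1` unless `y_{p+1} = c_p = -y_p`, when it is `3`), `(r, y_p) = +1` for clause-opening `p`;
  all other entries `0` (`isUnitCoupling_J`).
* **Energy bookkeeping** (`energy_eq`): `E = -(pair part) + Σ_p U_p + Σ_p F_p`, each of the
  `P + L + F` units being `≥ -1` (`P` = pairs of occurrences of one variable, `F` = clause-opening
  tokens), so `E ≥ -(P + L + F)` (`neg_units_le_energy`, Theorem A); and
  `E = -(P + L + F)` is attained iff the token list is satisfiable (`exists_energy_eq_iff`,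
  Theorem B): at equality every unit is tight (`tight`), the copy spins are consistent and define
  an assignment (`assignmentOf`), and along each clause the obligation `y = r` propagates
  (`propagate`) until a true literal is met (`tsat_of_energy_eq`); conversely a satisfying
  assignment with `y_p :=` suffix disjunctions is tight everywhere (`energy_spinsOf`).
* **CNF interface.** With the threshold `K_φ = -(P + L + m)`, `m` the number of clauses (an empty
  clause contributes to `m` but to no unit, so `K_φ` becomes unattainable):
  `(∃ σ, E_{J(tokens φ)}(σ) ≤ K_φ) ↔ φ.Satisfiable` (`exists_energy_le_threshold_iff`); and the
  ordered count `#{(p, q) | var_p = var_q} = 2P + L` (`orderedPairCount_eq`, the quantity a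
  machine's double loop produces).

The polynomial-time machines producing the code of `J(tokens φ)` and the assembly of
`SignProblemNPHard_holds` are in the sibling files `SignProblemNPHardMachines.lean`,
`SignProblemNPHardProofs.lean`.

## References

* M. Troyer, U.-J. Wiese, PRL 94 (2005) 170201, Letter p. 4 (the role of the spin-glass ground
  state problem in the NP-hardness of the sign problem).
* F. Barahona, J. Phys. A 15 (1982) 3241–3253, §4.2 (NP-hardness of spin-glass ground states;
  replaced here by a direct reduction from CNF satisfiability).
* S. A. Cook, Proc. 3rd STOC (1971), Thm. 1; S. Arora, B. Barak, *Computational Complexity*,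
  CUP 2009, §2.3 (CNF satisfiability, the source problem).
-/

namespace Literature.Barriers.HubbardSuperconductivity

open Literature.Computability.Complexity Finset

namespace CNFIsing

/-! ### Tokens: flattened literal occurrences -/

/-- A literal occurrence of a CNF, flattened: its variable, its polarity, and whether it is the
first literal of its clause. [folklore] -/
structure Token (α : Type) where
  /-- the variable of the literal -/
  var : α
  /-- the polarity (`true` = positive literal) -/
  pol : Bool
  /-- whether the occurrence opens a clause -/
  first : Bool
deriving DecidableEq

variable {α : Type}

/-- The tokens of a clause, the flag of the first one being `b`. [folklore] -/
def clauseTokens : Bool → Clause α → List (Token α)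
  | _, [] => []
  | b, l :: c => ⟨l.1, l.2, b⟩ :: clauseTokens false c

/-- The token list of a CNF: its literal occurrences in order, each clause opened by a flagged
token (empty clauses leave no trace). [folklore] -/
def tokens (φ : CNF α) : List (Token α) :=
  (φ.map (clauseTokens true)).flatten

/-- The value of the literal of a token under an assignment. [folklore] -/
def Token.eval (x : α → Bool) (t : Token α) : Bool :=
  x t.var == t.pol

/-! ### Spins: the reference spin, a copy spin and an auxiliary spin per token -/

/-- Position of an entity in the spin enumeration: the reference spin `r` is spin `0`, the copy
spin `c_p` of token `p` is spin `2p + 1`, its auxiliary spin `y_p` is spin `2p + 2`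
(entities: `none = r`, `some (p, false) = c_p`, `some (p, true) = y_p`). [folklore] -/
def idxN {L : ℕ} : Option (Fin L × Bool) → ℕ
  | none => 0
  | some (p, b) => b.toNat + 2 * p.val + 1

/-- Entity positions are below `2L + 1`. [folklore] -/
theorem idxN_lt {L : ℕ} (e : Option (Fin L × Bool)) : idxN e < L * 2 + 1 := by
  rcases e with _ | ⟨p, b⟩
  · simp [idxN]
  · cases b <;> simp [idxN] <;> omega

/-- The entity at a spin index. [folklore] -/
def entOf {L : ℕ} (i : Fin (L * 2 + 1)) : Option (Fin L × Bool) :=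
  if h : i.val = 0 then none
  else some (⟨(i.val - 1) / 2, by omega⟩, decide ((i.val - 1) % 2 = 1))

/-- `entOf` inverts `idxN`. [folklore] -/
theorem entOf_idxN {L : ℕ} (e : Option (Fin L × Bool)) : entOf ⟨idxN e, idxN_lt e⟩ = e := by
  rcases e with _ | ⟨p, b⟩
  · simp [idxN, entOf]
  · cases b
    · simp only [entOf, idxN, Bool.toNat_false]
      rw [dif_neg (by omega)]
      congr 2
      · ext; simp
      · simp
    · simp only [entOf, idxN, Bool.toNat_true]
      rw [dif_neg (by omega)]
      congr 2
      · ext; simp; omega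
      · simp

/-- `idxN` inverts `entOf`. [folklore] -/
theorem idxN_entOf {L : ℕ} (i : Fin (L * 2 + 1)) : idxN (entOf i) = i.val := by
  unfold entOf
  split_ifs with h
  · simp [idxN, h]
  · simp only [idxN]
    by_cases h2 : (i.val - 1) % 2 = 1
    · simp [h2]; omega
    · simp [h2]; omega

/-- Spin indices `Fin (2L + 1)` versus entities `r`, `c_p`, `y_p`. [folklore] -/
def ent (L : ℕ) : Fin (L * 2 + 1) ≃ Option (Fin L × Bool) where
  toFun := entOf
  invFun e := ⟨idxN e, idxN_lt e⟩
  left_inv i := Fin.ext (idxN_entOf i)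
  right_inv e := entOf_idxN e

/-- The spin index of an entity is its position. [folklore] -/
@[simp] theorem ent_symm_val (L : ℕ) (e : Option (Fin L × Bool)) : ((ent L).symm e).val = idxN e :=
  rfl

/-- The entity of spin `i` is `e` iff `i` is the position of `e`. [folklore] -/
theorem ent_eq_iff {L : ℕ} (i : Fin (L * 2 + 1)) (e : Option (Fin L × Bool)) :
    ent L i = e ↔ i.val = idxN e := by
  rw [← ent_symm_val, ← Fin.ext_iff, ← Equiv.eq_symm_apply]

/-- Spin `0` is the reference spin. [folklore] -/
theorem ent_zero (L : ℕ) : ent L 0 = none :=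
  (ent_eq_iff 0 none).2 rfl

/-- Spin `2p + 1` is the copy spin of token `p`. [folklore] -/
theorem ent_copy {L : ℕ} (p : Fin L) (h : 2 * p.val + 1 < L * 2 + 1) :
    ent L ⟨2 * p.val + 1, h⟩ = some (p, false) :=
  (ent_eq_iff _ _).2 (by simp [idxN])

/-- Spin `2p + 2` is the auxiliary spin of token `p`. [folklore] -/
theorem ent_aux {L : ℕ} (p : Fin L) (h : 2 * p.val + 2 < L * 2 + 1) :
    ent L ⟨2 * p.val + 2, h⟩ = some (p, true) :=
  (ent_eq_iff _ _).2 (by simp [idxN]; ring)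

/-! ### The coupling matrix -/

section Couplings

variable [DecidableEq α] (T : List (Token α))

/-- `Rel T p q`: token `q` is the successor of `p` inside the same clause. [folklore] -/
def Rel (p q : Fin T.length) : Prop :=
  q.val = p.val + 1 ∧ (T[q]).first = false

/-- `Rel` is decidable (a conjunction of a numeric and a Boolean equation). [folklore] -/
instance (p q : Fin T.length) : Decidable (Rel T p q) := by
  unfold Rel; infer_instance

/-- The sign `±1` of the consistency coupling between two occurrences: `+1` for equal
polarities. [folklore] -/
def pm (p q : Fin T.length) : ℤ :=
  if (T[p]).pol = (T[q]).pol then 1 else -1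

/-- The couplings between entities (only pairs in increasing position matter):
`(c_p, c_q) = [var_p = var_q] · pm`, `(c_p, y_p) = 1`, `(c_p, y_{p+1}) = -1` and
`(y_p, y_{p+1}) = 1` inside a clause, `(r, y_p) = 1` for clause-opening `p`. [folklore] -/
def coupling : Option (Fin T.length × Bool) → Option (Fin T.length × Bool) → ℤ
  | none, some (q, true) => if (T[q]).first = true then 1 else 0
  | some (p, false), some (q, false) => if (T[p]).var = (T[q]).var then pm T p q else 0
  | some (p, false), some (q, true) => if q = p then 1 else if Rel T p q then -1 else 0
  | some (p, true), some (q, true) => if Rel T p q then 1 else 0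
  | _, _ => 0

/-- The coupling matrix `J_T` on `2L + 1` spins. [folklore] -/
def J : Matrix (Fin (T.length * 2 + 1)) (Fin (T.length * 2 + 1)) ℤ :=
  fun i j => coupling T (ent _ i) (ent _ j)

omit [DecidableEq α] in
/-- `pm` is a sign. [folklore] -/
theorem pm_eq_or (p q : Fin T.length) : pm T p q = 1 ∨ pm T p q = -1 := by
  unfold pm; split_ifs <;> simp

/-- Every coupling is `0` or `±1`. [folklore] -/
theorem coupling_unit (e e' : Option (Fin T.length × Bool)) :
    coupling T e e' = 0 ∨ coupling T e e' = 1 ∨ coupling T e e' = -1 := by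
  rcases e with _ | ⟨p, _ | _⟩ <;> rcases e' with _ | ⟨q, _ | _⟩ <;> simp only [coupling] <;>
    (try split_ifs) <;> first | simp | exact Or.inr (pm_eq_or T _ _)

/-- `J_T` has unit couplings. [folklore] -/
theorem isUnitCoupling_J : IsUnitCoupling (J T) :=
  fun _ _ => coupling_unit T _ _

end Couplings

/-! ### The energy as a sum of gadget units -/

section Energy

variable [DecidableEq α] (T : List (Token α)) (σ : Fin (T.length * 2 + 1) → Bool)

/-- The Ising spin `±1` of an entity. [folklore] -/
def spin (e : Option (Fin T.length × Bool)) : ℤ :=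
  spinSign σ ((ent T.length).symm e)

/-- The spin of the reference entity `r`. [folklore] -/
abbrev sr : ℤ := spin T σ none

/-- The copy spin `c_p` of token `p`. [folklore] -/
abbrev sc (p : Fin T.length) : ℤ := spin T σ (some (p, false))

/-- The auxiliary spin `y_p` of token `p`. [folklore] -/
abbrev sy (p : Fin T.length) : ℤ := spin T σ (some (p, true))

omit [DecidableEq α] in
/-- Spins are `±1`. [folklore] -/
theorem spin_eq_or (e : Option (Fin T.length × Bool)) : spin T σ e = 1 ∨ spin T σ e = -1 := by
  unfold spin spinSign; split_ifs <;> simp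

/-- The summand of the energy double sum over entities. [folklore] -/
def term (e e' : Option (Fin T.length × Bool)) : ℤ :=
  if idxN e < idxN e' then coupling T e e' * spin T σ e * spin T σ e' else 0

/-- The energy as a double sum over entities. [folklore] -/
theorem energy_eq_sum_term : isingEnergy (J T) σ = -∑ e, ∑ e', term T σ e e' := by
  unfold isingEnergy
  rw [← Equiv.sum_comp (ent T.length).symm]
  congr 1
  refine Finset.sum_congr rfl fun e _ => ?_
  rw [← Equiv.sum_comp (ent T.length).symm]
  refine Finset.sum_congr rfl fun e' _ => ?_
  simp only [J, Equiv.apply_symm_apply, term, spin, Fin.lt_def, ent_symm_val]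

omit [DecidableEq α] in
/-- Sums over entities: the reference entity, then copy and auxiliary entity per token.
[folklore] -/
theorem sum_ent (f : Option (Fin T.length × Bool) → ℤ) :
    ∑ e, f e = f none + ∑ p, (f (some (p, false)) + f (some (p, true))) := by
  rw [Fintype.sum_option, Fintype.sum_prod_type]
  simp [add_comm]

/-- Block `(r, r)`. [folklore] -/
theorem term_none_none : term T σ none none = 0 := by simp [term, idxN]

/-- Block `(r, c_q)`. [folklore] -/
theorem term_none_copy (q : Fin T.length) : term T σ none (some (q, false)) = 0 := by
  simp [term, coupling]

/-- Block `(r, y_q)`: the clause-closing couplings. [folklore] -/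
theorem term_none_aux (q : Fin T.length) :
    term T σ none (some (q, true)) = if (T[q]).first = true then sr T σ * sy T σ q else 0 := by
  simp only [term, idxN, coupling]
  split_ifs <;> simp_all

/-- Block `(c_p, r)` / `(y_p, r)`. [folklore] -/
theorem term_some_none (p : Fin T.length) (b : Bool) : term T σ (some (p, b)) none = 0 := by
  simp [term, idxN]

/-- Block `(c_p, c_q)`: the consistency couplings. [folklore] -/
theorem term_copy_copy (p q : Fin T.length) :
    term T σ (some (p, false)) (some (q, false)) =
      if p < q ∧ (T[p]).var = (T[q]).var then pm T p q * sc T σ p * sc T σ q else 0 := by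
  simp only [term, idxN, coupling, Bool.toNat_false, Fin.lt_def]
  by_cases h : p.val < q.val
  · simp only [show 0 + 2 * p.val + 1 < 0 + 2 * q.val + 1 ↔ True from iff_true_intro (by omega), if_true, h,
      true_and]
    split_ifs <;> simp
  · simp only [show ¬(0 + 2 * p.val + 1 < 0 + 2 * q.val + 1) from by omega, if_false, h, false_and]

/-- Block `(c_p, y_q)`: the tie `(c_p, y_p)` and the antiferromagnetic triangle edge
`(c_p, y_{p+1})`. [folklore] -/
theorem term_copy_aux (p q : Fin T.length) :
    term T σ (some (p, false)) (some (q, true)) =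
      (if q = p then sc T σ p * sy T σ p else 0) + (if Rel T p q then -(sc T σ p * sy T σ q) else 0) := by
  simp only [term, idxN, coupling, Bool.toNat_false, Bool.toNat_true]
  by_cases hqp : q = p
  · subst hqp
    have : ¬Rel T q q := fun h => by unfold Rel at h; omega
    simp [this]
  · by_cases hr : Rel T p q
    · have hq : q.val = p.val + 1 := hr.1
      simp only [hqp, hr, hq, if_true, if_false, zero_add]
      rw [if_pos (by omega)]
      ring
    · simp [hqp, hr]

/-- Block `(y_p, c_q)`. [folklore] -/
theorem term_aux_copy (p q : Fin T.length) : term T σ (some (p, true)) (some (q, false)) = 0 := by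
  simp [term, coupling]

/-- Block `(y_p, y_q)`: the ferromagnetic triangle edge `(y_p, y_{p+1})`. [folklore] -/
theorem term_aux_aux (p q : Fin T.length) :
    term T σ (some (p, true)) (some (q, true)) = if Rel T p q then sy T σ p * sy T σ q else 0 := by
  simp only [term, idxN, coupling, Bool.toNat_true]
  by_cases hr : Rel T p q
  · have hq : q.val = p.val + 1 := hr.1
    simp [hr, hq]
  · simp [hr]

/-- The consistency part of the energy: `Σ_{p<q, same variable} ± c_p c_q`. [folklore] -/
def pairPart : ℤ :=
  ∑ p, ∑ q, if p < q ∧ (T[p]).var = (T[q]).var then pm T p q * sc T σ p * sc T σ q else 0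

/-- The clause-chain unit of token `p`: the frustrated triangle on `(y_{p+1}, c_p; y_p)` if the
clause continues after `p`, the tie `-c_p y_p` otherwise. [folklore] -/
def unitU (p : Fin T.length) : ℤ :=
  -(sc T σ p * sy T σ p) + ∑ q, if Rel T p q then sy T σ q * sc T σ p - sy T σ q * sy T σ p else 0

/-- The clause-closing unit of a clause-opening token `p`: `-r y_p`. [folklore] -/
def finalF (p : Fin T.length) : ℤ :=
  if (T[p]).first = true then -(sr T σ * sy T σ p) else 0

/-- **The energy of `J_T` is the sum of its gadget units.** [folklore] -/
theorem energy_eq :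
    isingEnergy (J T) σ = -pairPart T σ + ∑ p, unitU T σ p + ∑ p, finalF T σ p := by
  rw [energy_eq_sum_term, sum_ent]
  simp only [sum_ent T (fun e' => term T σ _ e'), term_none_none, term_none_copy, term_none_aux,
    term_some_none, term_copy_copy, term_copy_aux, term_aux_copy, term_aux_aux, zero_add,
    Finset.sum_add_distrib, Finset.sum_ite_eq', Finset.mem_univ, if_true]
  simp only [pairPart, unitU, finalF, Finset.sum_add_distrib, Finset.sum_neg_distrib]
  have h1 : ∀ p : Fin T.length,
      (∑ q, if Rel T p q then sy T σ q * sc T σ p - sy T σ q * sy T σ p else (0 : ℤ)) =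
        -(∑ q, if Rel T p q then -(sc T σ p * sy T σ q) else (0 : ℤ)) -
          ∑ q, if Rel T p q then sy T σ p * sy T σ q else (0 : ℤ) := by
    intro p
    rw [← Finset.sum_neg_distrib, ← Finset.sum_sub_distrib]
    refine Finset.sum_congr rfl fun q _ => ?_
    split_ifs <;> ring
  have h2 : (∑ p, if (T[p]).first = true then -(sr T σ * sy T σ p) else (0 : ℤ)) =
      -∑ p, if (T[p]).first = true then sr T σ * sy T σ p else (0 : ℤ) := by
    rw [← Finset.sum_neg_distrib]
    refine Finset.sum_congr rfl fun p _ => ?_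
    split_ifs <;> ring
  simp only [h1, h2, Finset.sum_sub_distrib, Finset.sum_neg_distrib]
  ring

end Energy

/-! ### Signs -/

/-- `a = ±1`. [folklore] -/
def IsSign (a : ℤ) : Prop := a = 1 ∨ a = -1

namespace IsSign

/-- Products of signs are signs. [folklore] -/
theorem mul {a b : ℤ} (ha : IsSign a) (hb : IsSign b) : IsSign (a * b) := by
  rcases ha with rfl | rfl <;> rcases hb with rfl | rfl <;> simp [IsSign]

/-- A sign is at most `1`. [folklore] -/
theorem le_one {a : ℤ} (ha : IsSign a) : a ≤ 1 := by
  rcases ha with rfl | rfl <;> norm_num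

/-- A sign is at least `-1`. [folklore] -/
theorem neg_one_le {a : ℤ} (ha : IsSign a) : -1 ≤ a := by
  rcases ha with rfl | rfl <;> norm_num

/-- Two signs with product `1` are equal. [folklore] -/
theorem eq_of_mul_eq_one {a b : ℤ} (ha : IsSign a) (hb : IsSign b) (h : a * b = 1) : a = b := by
  rcases ha with rfl | rfl <;> rcases hb with rfl | rfl <;> simp_all

/-- **The frustrated triangle**: for signs `a, b, y`, `ab - ay - by ≥ -1` … [folklore] -/
theorem triangle_ge {a b y : ℤ} (ha : IsSign a) (hb : IsSign b) (hy : IsSign y) :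
    -1 ≤ -(b * y) + (a * b - a * y) := by
  rcases ha with rfl | rfl <;> rcases hb with rfl | rfl <;> rcases hy with rfl | rfl <;> norm_num

/-- … with equality iff not `a = b = -y`; in particular, at equality, if `y = r` then `b = r` or
`a = r`. [folklore] -/
theorem triangle_tight {a b y r : ℤ} (ha : IsSign a) (hb : IsSign b) (hy : IsSign y) (hr : IsSign r)
    (h : -(b * y) + (a * b - a * y) = -1) (hyr : y = r) : b = r ∨ a = r := by
  subst hyr
  rcases ha with rfl | rfl <;> rcases hb with rfl | rfl <;> rcases hy with rfl | rfl <;> omega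

/-- The triangle is tight when `y = a ∨ b` (as signs relative to `+1`): all four cases. [folklore] -/
theorem triangle_eq {a b y : ℤ} (ha : IsSign a) (hb : IsSign b) (hy : y = if a = 1 ∨ b = 1 then 1 else -1) :
    -(b * y) + (a * b - a * y) = -1 := by
  subst hy
  rcases ha with rfl | rfl <;> rcases hb with rfl | rfl <;> norm_num

end IsSign

section Bounds

variable [DecidableEq α] (T : List (Token α)) (σ : Fin (T.length * 2 + 1) → Bool)

omit [DecidableEq α] in
/-- Spins are signs. [folklore] -/
theorem isSign_spin (e : Option (Fin T.length × Bool)) : IsSign (spin T σ e) :=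
  spin_eq_or T σ e

omit [DecidableEq α] in
/-- `pm` is a sign. [folklore] -/
theorem isSign_pm (p q : Fin T.length) : IsSign (pm T p q) :=
  pm_eq_or T p q

/-- The number `P_T` of pairs `p < q` of occurrences of the same variable. [folklore] -/
def pairCount : ℕ :=
  ∑ p : Fin T.length, ∑ q : Fin T.length, if p < q ∧ (T[p]).var = (T[q]).var then 1 else 0

omit [DecidableEq α] in
/-- The number `F_T` of clause-opening tokens. [folklore] -/
def firstCount : ℕ :=
  ∑ p : Fin T.length, if (T[p]).first = true then 1 else 0

/-- The number of gadget units `P_T + L + F_T`: minus the least conceivable energy. [folklore] -/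
def units : ℕ :=
  pairCount T + T.length + firstCount T

/-- **Ordered pairs of occurrences of the same variable, diagonal included, number `2 P_T + L`.**
(This is the count a double loop over all ordered pairs of tokens produces.) [folklore] -/
theorem orderedPairCount_eq :
    (∑ p : Fin T.length, ∑ q : Fin T.length, if (T[p]).var = (T[q]).var then 1 else 0) =
      2 * pairCount T + T.length := by
  have hsplit : ∀ p q : Fin T.length, (if (T[p]).var = (T[q]).var then 1 else 0) =
      (if p < q ∧ (T[p]).var = (T[q]).var then 1 else 0) + (if p = q then 1 else 0) +
        (if q < p ∧ (T[q]).var = (T[p]).var then 1 else 0) := by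
    intro p q
    rcases lt_trichotomy p q with h | rfl | h
    · have h' : ¬q < p := fun h' => lt_asymm h h'
      simp [h, h.ne, h']
    · simp
    · have h' : ¬p < q := fun h' => lt_asymm h h'
      simp [h, h.ne', h', eq_comm]
  simp only [hsplit, Finset.sum_add_distrib, Finset.sum_ite_eq, Finset.mem_univ, if_true,
    Finset.sum_const, Finset.card_univ, Fintype.card_fin, smul_eq_mul, mul_one]
  have hswap : (∑ p : Fin T.length, ∑ q : Fin T.length, if q < p ∧ (T[q]).var = (T[p]).var then 1 else 0) =
      pairCount T := by
    rw [pairCount, Finset.sum_comm]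
  rw [hswap, pairCount]
  ring

/-- The consistency part is at most the number of pairs. [folklore] -/
theorem pairPart_le : pairPart T σ ≤ pairCount T := by
  unfold pairPart pairCount
  push_cast
  refine Finset.sum_le_sum fun p _ => Finset.sum_le_sum fun q _ => ?_
  split_ifs
  · exact (((isSign_pm T p q).mul (isSign_spin T σ _)).mul (isSign_spin T σ _)).le_one
  · exact le_rfl

omit [DecidableEq α] in
/-- At most one token is the in-clause successor of `p`. [folklore] -/
theorem rel_unique {p q q' : Fin T.length} (hq : Rel T p q) (hq' : Rel T p q') : q = q' :=
  Fin.ext (by rw [hq.1, hq'.1])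

omit [DecidableEq α] in
/-- The chain unit of `p` with an in-clause successor `q` is the frustrated triangle. [folklore] -/
theorem unitU_eq_of_rel {p q : Fin T.length} (hq : Rel T p q) :
    unitU T σ p = -(sc T σ p * sy T σ p) + (sy T σ q * sc T σ p - sy T σ q * sy T σ p) := by
  unfold unitU
  congr 1
  rw [Finset.sum_eq_single_of_mem q (Finset.mem_univ q)]
  · rw [if_pos hq]
  · intro q' _ hne
    rw [if_neg]
    exact fun h => hne (rel_unique T h hq)

omit [DecidableEq α] in
/-- The chain unit of a clause-final `p` is the tie `-c_p y_p`. [folklore] -/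
theorem unitU_eq_of_not_rel {p : Fin T.length} (hq : ∀ q, ¬Rel T p q) :
    unitU T σ p = -(sc T σ p * sy T σ p) := by
  unfold unitU
  rw [Finset.sum_eq_zero fun q _ => if_neg (hq q), add_zero]

omit [DecidableEq α] in
/-- Every chain unit is at least `-1`. [folklore] -/
theorem neg_one_le_unitU (p : Fin T.length) : -1 ≤ unitU T σ p := by
  by_cases h : ∃ q, Rel T p q
  · obtain ⟨q, hq⟩ := h
    rw [unitU_eq_of_rel T σ hq]
    exact IsSign.triangle_ge (isSign_spin T σ _) (isSign_spin T σ _) (isSign_spin T σ _)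
  · push Not at h
    rw [unitU_eq_of_not_rel T σ h]
    have := ((isSign_spin T σ (some (p, false))).mul (isSign_spin T σ (some (p, true)))).le_one
    linarith

omit [DecidableEq α] in
/-- Every closing unit is at least `-[p opens a clause]`. [folklore] -/
theorem neg_le_finalF (p : Fin T.length) :
    -(if (T[p]).first = true then (1 : ℤ) else 0) ≤ finalF T σ p := by
  unfold finalF
  split_ifs
  · have := ((isSign_spin T σ none).mul (isSign_spin T σ (some (p, true)))).le_one
    linarith
  · exact le_rfl

/-- **Theorem A: the energy is at least `-(P_T + L + F_T)`.** [folklore] -/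
theorem neg_units_le_energy : -(units T : ℤ) ≤ isingEnergy (J T) σ := by
  rw [energy_eq, units]
  have h1 := pairPart_le T σ
  have h2 : (∑ _p : Fin T.length, (-1 : ℤ)) ≤ ∑ p, unitU T σ p :=
    Finset.sum_le_sum fun p _ => neg_one_le_unitU T σ p
  have h3 : (∑ p : Fin T.length, -(if (T[p]).first = true then (1 : ℤ) else 0)) ≤ ∑ p, finalF T σ p :=
    Finset.sum_le_sum fun p _ => neg_le_finalF T σ p
  have h4 : (firstCount T : ℤ) = ∑ p : Fin T.length, if (T[p]).first = true then (1 : ℤ) else 0 := by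
    unfold firstCount; push_cast; rfl
  simp only [Finset.sum_const, Finset.card_univ, Fintype.card_fin, smul_neg, nsmul_eq_mul, mul_one,
    Finset.sum_neg_distrib] at h2 h3
  push_cast
  linarith

end Bounds

/-! ### Tightness: energy `-(P_T + L + F_T)` forces every unit to its minimum -/

section Tight

variable [DecidableEq α] (T : List (Token α)) (σ : Fin (T.length * 2 + 1) → Bool)

/-- At energy `-(P_T + L + F_T)` every consistency pair, chain unit and closing unit is at its
minimum. [folklore] -/
theorem tight (h : isingEnergy (J T) σ = -(units T : ℤ)) :
    (∀ p q : Fin T.length, p < q → (T[p]).var = (T[q]).var → pm T p q * sc T σ p * sc T σ q = 1) ∧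
      (∀ p, unitU T σ p = -1) ∧ (∀ p : Fin T.length, (T[p]).first = true → sr T σ * sy T σ p = 1) := by
  rw [energy_eq, units] at h
  push_cast at h
  -- the three nonnegative slacks
  set A : ℤ := ∑ p : Fin T.length, ∑ q : Fin T.length,
    ((if p < q ∧ (T[p]).var = (T[q]).var then (1 : ℤ) else 0) -
      (if p < q ∧ (T[p]).var = (T[q]).var then pm T p q * sc T σ p * sc T σ q else 0)) with hA
  set B : ℤ := ∑ p : Fin T.length, (unitU T σ p + 1) with hB
  set C : ℤ := ∑ p : Fin T.length, (finalF T σ p + if (T[p]).first = true then (1 : ℤ) else 0) with hC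
  have hAt : ∀ p q : Fin T.length, 0 ≤ (if p < q ∧ (T[p]).var = (T[q]).var then (1 : ℤ) else 0) -
      (if p < q ∧ (T[p]).var = (T[q]).var then pm T p q * sc T σ p * sc T σ q else 0) := by
    intro p q
    split_ifs
    · have := (((isSign_pm T p q).mul (isSign_spin T σ (some (p, false)))).mul
        (isSign_spin T σ (some (q, false)))).le_one
      linarith
    · exact le_rfl
  have hA0 : 0 ≤ A := Finset.sum_nonneg fun p _ => Finset.sum_nonneg fun q _ => hAt p q
  have hBt : ∀ p, 0 ≤ unitU T σ p + 1 := fun p => by have := neg_one_le_unitU T σ p; linarith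
  have hB0 : 0 ≤ B := Finset.sum_nonneg fun p _ => hBt p
  have hCt : ∀ p : Fin T.length, 0 ≤ finalF T σ p + (if (T[p]).first = true then (1 : ℤ) else 0) :=
    fun p => by have := neg_le_finalF T σ p; linarith
  have hC0 : 0 ≤ C := Finset.sum_nonneg fun p _ => hCt p
  have hsum : A + B + C = 0 := by
    have hA' : A = (pairCount T : ℤ) - pairPart T σ := by
      rw [hA, pairCount, pairPart]
      push_cast
      rw [← Finset.sum_sub_distrib]
      refine Finset.sum_congr rfl fun p _ => ?_
      rw [← Finset.sum_sub_distrib]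
    have hB' : B = ∑ p, unitU T σ p + T.length := by
      rw [hB, Finset.sum_add_distrib]; simp
    have hC' : C = ∑ p, finalF T σ p + firstCount T := by
      rw [hC, Finset.sum_add_distrib, firstCount]; push_cast; rfl
    rw [hA', hB', hC']
    linarith
  have hA1 : A = 0 := by linarith
  have hB1 : B = 0 := by linarith
  have hC1 : C = 0 := by linarith
  refine ⟨fun p q hpq hv => ?_, fun p => ?_, fun p hp => ?_⟩
  · have h1 := (Finset.sum_eq_zero_iff_of_nonneg fun p _ => Finset.sum_nonneg fun q _ => hAt p q).1 hA1 p
      (Finset.mem_univ p)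
    have h2 := (Finset.sum_eq_zero_iff_of_nonneg fun q _ => hAt p q).1 h1 q (Finset.mem_univ q)
    rw [if_pos ⟨hpq, hv⟩, if_pos ⟨hpq, hv⟩] at h2
    linarith
  · have := (Finset.sum_eq_zero_iff_of_nonneg fun p _ => hBt p).1 hB1 p (Finset.mem_univ p)
    linarith
  · have := (Finset.sum_eq_zero_iff_of_nonneg fun p _ => hCt p).1 hC1 p (Finset.mem_univ p)
    rw [finalF, if_pos hp, if_pos hp] at this
    linarith

omit [DecidableEq α] in
/-- Two spins with product `1` agree; in terms of the reference spin: `a = r ↔ b = r`. [folklore] -/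
theorem spin_eq_iff_of_mul (e e' : Option (Fin T.length × Bool)) :
    spin T σ e = spin T σ e' ↔ (spin T σ e = sr T σ ↔ spin T σ e' = sr T σ) := by
  rcases isSign_spin T σ e with h | h <;> rcases isSign_spin T σ e' with h' | h' <;>
    rcases isSign_spin T σ none with hr | hr <;> simp [sr, h, h', hr]

omit [DecidableEq α] in
/-- **Propagation along a clause chain**: at tightness, if `y_k = r` but `c_k ≠ r` then the clause
continues after `k` and `y_{k+1} = r`. [folklore] -/
theorem propagate (hU : ∀ p, unitU T σ p = -1) (k : Fin T.length) (hy : sy T σ k = sr T σ)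
    (hc : sc T σ k ≠ sr T σ) :
    ∃ hk : k.val + 1 < T.length, (T[k.val + 1]).first = false ∧ sy T σ ⟨k.val + 1, hk⟩ = sr T σ := by
  by_cases hrel : ∃ q, Rel T k q
  · obtain ⟨q, hq⟩ := hrel
    have hqv : q.val = k.val + 1 := hq.1
    have hk : k.val + 1 < T.length := hqv ▸ q.isLt
    have hq' : (⟨k.val + 1, hk⟩ : Fin T.length) = q := Fin.ext hqv.symm
    refine ⟨hk, ?_, ?_⟩
    · have := hq.2; simp only [← hqv]; simpa using this
    · rw [hq']
      have ht := hU k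
      rw [unitU_eq_of_rel T σ hq] at ht
      rcases IsSign.triangle_tight (isSign_spin T σ _) (isSign_spin T σ _) (isSign_spin T σ _)
        (isSign_spin T σ none) ht hy with h | h
      · exact absurd h hc
      · exact h
  · push Not at hrel
    have ht := hU k
    rw [unitU_eq_of_not_rel T σ hrel] at ht
    have : sc T σ k = sy T σ k :=
      IsSign.eq_of_mul_eq_one (isSign_spin T σ _) (isSign_spin T σ _) (by linarith)
    exact absurd (this.trans hy) hc

end Tight

/-! ### Clause satisfaction read off a token list -/

section Sat

/-- Satisfaction of the clauses of a token list under `x`, scanning left to right with a pending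
obligation: a clause-opening token requires the previous clause to be discharged and opens a new
obligation unless its literal is true; other tokens discharge the obligation when true; at the end
nothing may be pending. (Tokens before the first clause-opening one impose nothing.) [folklore] -/
def satGo (x : α → Bool) : List (Token α) → Bool → Bool
  | [], pd => !pd
  | t :: S, pd => if t.first = true then !pd && satGo x S (!t.eval x) else satGo x S (pd && !t.eval x)

/-- The token list is satisfiable: some assignment discharges every clause. [folklore] -/
def TSat (T : List (Token α)) : Prop :=
  ∃ x : α → Bool, satGo x T false = true

/-- The auxiliary truth value of a position: the disjunction of the literals from there to the end
of its clause. [folklore] -/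
def yOf (x : α → Bool) : List (Token α) → Bool
  | [] => false
  | t :: S => t.eval x || (match S with | [] => false | t' :: _ => !t'.first) && yOf x S

/-- Whether a token list continues a clause (its head is not clause-opening). [folklore] -/
def contHead : List (Token α) → Bool
  | [] => false
  | t :: _ => !t.first

/-- Unfolding `yOf` at a cons. [folklore] -/
theorem yOf_cons (x : α → Bool) (t : Token α) (S : List (Token α)) :
    yOf x (t :: S) = (t.eval x || (contHead S && yOf x S)) := by
  cases S <;> simp [yOf, contHead]

/-- A pending obligation can only be met inside a continuing clause with a true literal ahead.
[folklore] -/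
theorem satGo_true (x : α → Bool) : ∀ S : List (Token α), satGo x S true = true →
    contHead S = true ∧ yOf x S = true
  | [], h => by simp [satGo] at h
  | t :: S, h => by
    by_cases hf : t.first = true
    · simp [satGo, hf] at h
    · refine ⟨by simp [contHead, hf], ?_⟩
      rw [yOf_cons]
      by_cases he : t.eval x = true
      · simp [he]
      · simp only [satGo, hf, Bool.true_and] at h
        have h' : satGo x S true = true := by simpa [he] using h
        have := satGo_true x S h'
        simp [this.1, this.2]

/-- **Every clause opened in a satisfied token list has a true literal**: `yOf` holds at each
clause-opening position. [folklore] -/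
theorem yOf_drop_of_satGo (x : α → Bool) : ∀ (S : List (Token α)) (pd : Bool), satGo x S pd = true →
    ∀ (k : ℕ) (hk : k < S.length), (S[k]).first = true → yOf x (S.drop k) = true
  | [], _, _, k, hk, _ => by simp at hk
  | t :: S, pd, h, 0, _, hf => by
    simp only [List.getElem_cons_zero] at hf
    simp only [satGo, hf, if_true, Bool.and_eq_true, Bool.not_eq_true'] at h
    rw [List.drop_zero, yOf_cons]
    by_cases he : t.eval x = true
    · simp [he]
    · have h' : satGo x S true = true := by simpa [he] using h.2
      have := satGo_true x S h'
      simp [this.1, this.2]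
  | t :: S, pd, h, k + 1, hk, hf => by
    rw [List.drop_succ_cons]
    simp only [List.getElem_cons_succ] at hf
    by_cases htf : t.first = true
    · simp only [satGo, htf, if_true, Bool.and_eq_true] at h
      exact yOf_drop_of_satGo x S _ h.2 k (by simpa using hk) hf
    · simp only [satGo, htf] at h
      exact yOf_drop_of_satGo x S _ h k (by simpa using hk) hf

end Sat

/-! ### Theorem B, first half: minimal energy gives a satisfying assignment -/

section FromSpins

variable [DecidableEq α] (T : List (Token α)) (σ : Fin (T.length * 2 + 1) → Bool)

open Classical in
/-- The assignment read off a spin configuration: a variable is set so that the literal of (some)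
occurrence `p` of it is true iff `c_p` agrees with the reference spin. [folklore] -/
noncomputable def assignmentOf (a : α) : Bool :=
  if h : ∃ p : Fin T.length, (T[p]).var = a then
    decide (sc T σ (Classical.choose h) = sr T σ) == (T[Classical.choose h]).pol
  else false

/-- Under consistency of the copy spins, the literal of every occurrence is true under
`assignmentOf` iff its copy spin agrees with the reference spin. [folklore] -/
theorem eval_assignmentOf
    (hcons : ∀ p q : Fin T.length, (T[p]).var = (T[q]).var → ((T[p]).pol = (T[q]).pol ↔ sc T σ p = sc T σ q))
    (q : Fin T.length) : (T[q]).eval (assignmentOf T σ) = decide (sc T σ q = sr T σ) := by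
  unfold Token.eval assignmentOf
  have h : ∃ p : Fin T.length, (T[p]).var = (T[q]).var := ⟨q, rfl⟩
  rw [dif_pos h]
  have hp : (T[Classical.choose h]).var = (T[q]).var := Classical.choose_spec h
  have hc := hcons _ q hp
  rw [spin_eq_iff_of_mul T σ] at hc
  generalize (T[Classical.choose h]).pol = a at hc ⊢
  generalize (T[q]).pol = b at hc ⊢
  by_cases h1 : sc T σ (Classical.choose h) = sr T σ <;> by_cases h2 : sc T σ q = sr T σ <;>
    cases a <;> cases b <;> simp_all

omit [DecidableEq α] in
omit [DecidableEq α] in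
/-- Tight consistency pairs make the copy spins consistent. [folklore] -/
theorem consistent_of_tight
    (hP : ∀ p q : Fin T.length, p < q → (T[p]).var = (T[q]).var → pm T p q * sc T σ p * sc T σ q = 1)
    (p q : Fin T.length) (hv : (T[p]).var = (T[q]).var) : (T[p]).pol = (T[q]).pol ↔ sc T σ p = sc T σ q := by
  have key : ∀ p q : Fin T.length, p < q → (T[p]).var = (T[q]).var →
      ((T[p]).pol = (T[q]).pol ↔ sc T σ p = sc T σ q) := by
    intro p q hpq hv
    have h := hP p q hpq hv
    unfold pm at h
    have hsq : sc T σ q * sc T σ q = 1 := by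
      rcases isSign_spin T σ (some (q, false)) with h' | h' <;> simp [sc, h']
    split_ifs at h with hpol
    · simp only [hpol, true_iff]
      exact IsSign.eq_of_mul_eq_one (isSign_spin T σ _) (isSign_spin T σ _) (by linarith)
    · simp only [hpol, false_iff]
      intro he
      rw [he, mul_assoc, hsq] at h
      norm_num at h
  rcases lt_trichotomy p q with h | rfl | h
  · exact key p q h hv
  · simp
  · rw [eq_comm, key q p h hv.symm, eq_comm]

/-- **Theorem B (⇒): energy `-(P_T + L + F_T)` makes the token list satisfiable.** [folklore] -/
theorem tsat_of_energy_eq (h : isingEnergy (J T) σ = -(units T : ℤ)) : TSat T := by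
  obtain ⟨hP, hU, hF⟩ := tight T σ h
  have hev := eval_assignmentOf T σ (consistent_of_tight T σ hP)
  refine ⟨assignmentOf T σ, ?_⟩
  -- scan the suffixes `T.drop k`, carrying the chain invariant
  suffices key : ∀ (S : List (Token α)) (k : ℕ) (pd : Bool), S = T.drop k →
      (pd = true → ∃ hk : k < T.length, (T[k]).first = false ∧ sy T σ ⟨k, hk⟩ = sr T σ) →
      satGo (assignmentOf T σ) S pd = true from
    key T 0 false (List.drop_zero).symm (by simp)
  intro S
  induction S with
  | nil =>
    intro k pd hS hpd
    cases pd
    · rfl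
    · obtain ⟨hk, -⟩ := hpd rfl
      have : (T.drop k).length = 0 := by rw [← hS]; rfl
      simp at this; omega
  | cons t S ih =>
    intro k pd hS hpd
    have hk : k < T.length := by
      by_contra hk'
      rw [List.drop_eq_nil_of_le (Nat.le_of_not_lt hk')] at hS
      cases hS
    rw [List.drop_eq_getElem_cons hk, List.cons.injEq] at hS
    obtain ⟨rfl, rfl⟩ := hS
    -- the common step: a pending obligation at `k` with a false literal propagates to `k + 1`
    have step : sy T σ ⟨k, hk⟩ = sr T σ → (T[k]).eval (assignmentOf T σ) = false →
        ∃ hk' : k + 1 < T.length, (T[k + 1]).first = false ∧ sy T σ ⟨k + 1, hk'⟩ = sr T σ := by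
      intro hy he
      have hc : sc T σ ⟨k, hk⟩ ≠ sr T σ := by
        have := hev ⟨k, hk⟩
        simp only [Fin.getElem_fin] at this
        rw [he] at this
        simpa using this
      exact propagate T σ hU ⟨k, hk⟩ hy hc
    by_cases hf : (T[k]).first = true
    · have hpd' : pd = false := by
        cases pd
        · rfl
        · obtain ⟨_, h1, -⟩ := hpd rfl
          rw [hf] at h1; cases h1
      subst hpd'
      simp only [satGo, hf, if_true, Bool.not_false, Bool.true_and]
      refine ih (k + 1) _ rfl fun hpd' => step ?_ (by simpa using hpd')
      have := hF ⟨k, hk⟩ hf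
      exact (IsSign.eq_of_mul_eq_one (isSign_spin T σ _) (isSign_spin T σ _) (by rw [mul_comm]; exact this)).symm
        |>.symm
    · simp only [satGo, hf]
      refine ih (k + 1) _ rfl fun hpd' => ?_
      simp only [Bool.and_eq_true, Bool.not_eq_true'] at hpd'
      obtain ⟨_, -, hy⟩ := hpd hpd'.1
      exact step hy hpd'.2

end FromSpins

/-! ### Theorem B, second half: a satisfying assignment gives minimal energy -/

section FromAssignment

variable [DecidableEq α] (T : List (Token α)) (x : α → Bool)

/-- The spin configuration of an assignment: `r = +1`, `c_p` the value of literal `p`, `y_p` the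
disjunction of the literals from `p` to the end of its clause. [folklore] -/
def spinsOf : Fin (T.length * 2 + 1) → Bool := fun i =>
  match ent T.length i with
  | none => true
  | some (p, false) => (T[p]).eval x
  | some (p, true) => yOf x (T.drop p.val)

omit [DecidableEq α] in
/-- The reference spin of `spinsOf` is `+1`. [folklore] -/
theorem sr_spinsOf : sr T (spinsOf T x) = 1 := by
  simp [sr, spin, spinSign, spinsOf]

omit [DecidableEq α] in
/-- The copy spins of `spinsOf`. [folklore] -/
theorem sc_spinsOf (p : Fin T.length) : sc T (spinsOf T x) p = if (T[p]).eval x = true then 1 else -1 := by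
  simp [sc, spin, spinSign, spinsOf]

omit [DecidableEq α] in
/-- The auxiliary spins of `spinsOf`. [folklore] -/
theorem sy_spinsOf (p : Fin T.length) :
    sy T (spinsOf T x) p = if yOf x (T.drop p.val) = true then 1 else -1 := by
  simp [sy, spin, spinSign, spinsOf]

omit [DecidableEq α] in
/-- `y_p = c_p ∨ y_{p+1}` inside a clause. [folklore] -/
theorem yOf_drop_of_rel {p q : Fin T.length} (hq : Rel T p q) :
    yOf x (T.drop p.val) = ((T[p]).eval x || yOf x (T.drop q.val)) := by
  have hqv : q.val = p.val + 1 := hq.1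
  have h2 : (T[q.val]).first = false := hq.2
  rw [List.drop_eq_getElem_cons p.isLt, yOf_cons, ← hqv, List.drop_eq_getElem_cons q.isLt]
  simp [contHead, h2]

omit [DecidableEq α] in
/-- `y_p = c_p` at the end of a clause. [folklore] -/
theorem yOf_drop_of_not_rel {p : Fin T.length} (hq : ∀ q, ¬Rel T p q) :
    yOf x (T.drop p.val) = (T[p]).eval x := by
  rw [List.drop_eq_getElem_cons p.isLt, yOf_cons]
  by_cases hp : p.val + 1 < T.length
  · have hf : (T[p.val + 1]).first = true := by
      by_contra hf
      exact hq ⟨p.val + 1, hp⟩ ⟨rfl, by simpa using hf⟩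
    rw [List.drop_eq_getElem_cons hp]
    simp [contHead, hf]
  · rw [List.drop_eq_nil_of_le (by omega)]
    simp [contHead]

omit [DecidableEq α] in
/-- Boolean bookkeeping of a consistency pair: `± c_p c_q = 1` for two literals on one variable.
[folklore] -/
theorem pair_aux (x : α → Bool) (t t' : Token α) (hv : t.var = t'.var) :
    ((if t.pol = t'.pol then (1 : ℤ) else -1) * (if t.eval x = true then 1 else -1) *
      if t'.eval x = true then 1 else -1) = 1 := by
  obtain ⟨v, a, f⟩ := t
  obtain ⟨v', b, f'⟩ := t'
  simp only at hv
  subst hv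
  cases a <;> cases b <;> cases h : x v <;> simp [Token.eval, h]

/-- **Theorem B (⇐): a satisfying assignment realises the energy `-(P_T + L + F_T)`.** [folklore] -/
theorem energy_spinsOf (hx : satGo x T false = true) :
    isingEnergy (J T) (spinsOf T x) = -(units T : ℤ) := by
  rw [energy_eq, units]
  have h1 : pairPart T (spinsOf T x) = pairCount T := by
    unfold pairPart pairCount
    push_cast
    refine Finset.sum_congr rfl fun p _ => Finset.sum_congr rfl fun q _ => ?_
    split_ifs with hpq
    · rw [pm, sc_spinsOf, sc_spinsOf]
      exact pair_aux x _ _ hpq.2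
    · rfl
  have h2 : ∀ p, unitU T (spinsOf T x) p = -1 := by
    intro p
    by_cases h : ∃ q, Rel T p q
    · obtain ⟨q, hq⟩ := h
      rw [unitU_eq_of_rel T _ hq]
      refine IsSign.triangle_eq (isSign_spin T _ _) (isSign_spin T _ _) ?_
      rw [sy_spinsOf, yOf_drop_of_rel T x hq, sy_spinsOf, sc_spinsOf]
      cases (T[p]).eval x <;> cases yOf x (T.drop q.val) <;> simp
    · push Not at h
      rw [unitU_eq_of_not_rel T _ h, sc_spinsOf, sy_spinsOf, yOf_drop_of_not_rel T x h]
      split_ifs <;> simp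
  have h3 : ∀ p : Fin T.length, finalF T (spinsOf T x) p = -(if (T[p]).first = true then (1 : ℤ) else 0) := by
    intro p
    unfold finalF
    split_ifs with hp
    · rw [sr_spinsOf, sy_spinsOf, yOf_drop_of_satGo x T false hx p.val p.isLt hp]
      simp
    · simp
  rw [h1, Finset.sum_congr rfl fun p _ => h2 p, Finset.sum_congr rfl fun p _ => h3 p, firstCount]
  push_cast
  simp only [Finset.sum_const, Finset.card_univ, Fintype.card_fin, smul_neg, nsmul_eq_mul, mul_one,
    Finset.sum_neg_distrib]
  ring

end FromAssignment

/-! ### Main theorem on token lists -/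

section Main

variable [DecidableEq α] (T : List (Token α))

/-- **Theorem B: the energy `-(P_T + L + F_T)` is attained iff the token list is satisfiable.**
[folklore] -/
theorem exists_energy_eq_iff : (∃ σ, isingEnergy (J T) σ = -(units T : ℤ)) ↔ TSat T :=
  ⟨fun ⟨σ, h⟩ => tsat_of_energy_eq T σ h, fun ⟨x, hx⟩ => ⟨spinsOf T x, energy_spinsOf T x hx⟩⟩

/-- **Ground-state form**: a configuration of energy `≤ -(P_T + L + F_T) - c` exists iff `c = 0`
and the token list is satisfiable. [folklore] -/
theorem exists_energy_le_iff (c : ℕ) :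
    (∃ σ, isingEnergy (J T) σ ≤ -(units T : ℤ) - c) ↔ c = 0 ∧ TSat T := by
  constructor
  · rintro ⟨σ, h⟩
    have hA := neg_units_le_energy T σ
    have hc : c = 0 := by omega
    subst hc
    exact ⟨rfl, (exists_energy_eq_iff T).1 ⟨σ, by push_cast at h; linarith⟩⟩
  · rintro ⟨rfl, h⟩
    obtain ⟨σ, hσ⟩ := (exists_energy_eq_iff T).2 h
    exact ⟨σ, by rw [hσ]; simp⟩

end Main

/-! ### The reduction on CNFs -/

section CNFInterface

/-- Scanning the non-opening tokens of a clause accumulates "no true literal so far". [folklore] -/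
theorem satGo_clauseTokens_false (x : α → Bool) : ∀ (c : Clause α) (S : List (Token α)) (pd : Bool),
    satGo x (clauseTokens false c ++ S) pd = satGo x S (pd && !c.any (Literal.eval x))
  | [], S, pd => by simp [clauseTokens]
  | l :: c, S, pd => by
    rw [clauseTokens, List.cons_append, satGo, if_neg (by simp), satGo_clauseTokens_false x c S]
    congr 1
    have : Token.eval x ⟨l.1, l.2, false⟩ = Literal.eval x l := rfl
    rw [this, List.any_cons]
    cases pd <;> cases Literal.eval x l <;> simp

/-- **Scanning the token list of a CNF checks its nonempty clauses.** [folklore] -/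
theorem satGo_tokens (x : α → Bool) : ∀ (φ : CNF α) (pd : Bool),
    satGo x (tokens φ) pd = (!pd && φ.all fun c => c.isEmpty || c.any (Literal.eval x))
  | [], pd => by simp [tokens, satGo]
  | [] :: φ, pd => by
    have : tokens ([] :: φ) = tokens φ := by simp [tokens, clauseTokens]
    rw [this, satGo_tokens x φ pd]
    simp
  | (l :: c) :: φ, pd => by
    have ht : tokens ((l :: c) :: φ) = ⟨l.1, l.2, true⟩ :: (clauseTokens false c ++ tokens φ) := by
      simp [tokens, clauseTokens]
    rw [ht, satGo, if_pos rfl, satGo_clauseTokens_false, satGo_tokens x φ]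
    have : Token.eval x ⟨l.1, l.2, true⟩ = Literal.eval x l := rfl
    rw [this, List.all_cons, List.any_cons]
    cases pd <;> cases Literal.eval x l <;> simp

/-- The token list of a CNF is satisfiable iff its nonempty clauses are simultaneously
satisfiable. [folklore] -/
theorem tsat_tokens_iff (φ : CNF α) :
    TSat (tokens φ) ↔ ∃ x : α → Bool, (φ.all fun c => c.isEmpty || c.any (Literal.eval x)) = true := by
  unfold TSat
  simp only [satGo_tokens, Bool.not_false, Bool.true_and]

/-- **A CNF is satisfiable iff it has no empty clause and its token list is satisfiable.**
[folklore] -/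
theorem satisfiable_iff_tsat (φ : CNF α) : φ.Satisfiable ↔ [] ∉ φ ∧ TSat (tokens φ) := by
  rw [tsat_tokens_iff]
  constructor
  · rintro ⟨x, hx⟩
    have hx' : ∀ c ∈ φ, c.any (Literal.eval x) = true := by
      simpa [CNF.eval, List.all_eq_true] using hx
    refine ⟨fun h => by simpa using hx' [] h, x, ?_⟩
    rw [List.all_eq_true]
    intro c hc
    simp [hx' c hc]
  · rintro ⟨hnil, x, hx⟩
    refine ⟨x, ?_⟩
    rw [CNF.eval, List.all_eq_true]
    rw [List.all_eq_true] at hx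
    intro c hc
    have h := hx c hc
    have hne : c.isEmpty = false := by
      cases c with
      | nil => exact absurd hc hnil
      | cons _ _ => rfl
    simpa [hne] using h

/-- The number of nonempty clauses. [folklore] -/
def nonemptyCount (φ : CNF α) : ℕ :=
  φ.countP fun c => !c.isEmpty

/-- There are at most as many nonempty clauses as clauses … [folklore] -/
theorem nonemptyCount_le (φ : CNF α) : nonemptyCount φ ≤ φ.length :=
  List.countP_le_length

/-- … with equality iff there is no empty clause. [folklore] -/
theorem nonemptyCount_eq_length_iff (φ : CNF α) : nonemptyCount φ = φ.length ↔ [] ∉ φ := by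
  rw [nonemptyCount, List.countP_eq_length]
  constructor
  · intro h hnil
    simpa using h [] hnil
  · intro h c hc
    cases c with
    | nil => exact absurd hc h
    | cons _ _ => rfl

/-- Summing the indicator of `first` counts the clause-opening tokens. [folklore] -/
theorem sum_map_first (T : List (Token α)) :
    (T.map fun t => if t.first = true then 1 else 0).sum = T.countP fun t => t.first := by
  induction T with
  | nil => rfl
  | cons t T ih =>
    rw [List.map_cons, List.sum_cons, ih, List.countP_cons]
    cases t.first <;> simp [add_comm]

/-- `F_T` as a count over the list. [folklore] -/
theorem firstCount_eq_countP (T : List (Token α)) : firstCount T = T.countP fun t => t.first := by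
  unfold firstCount
  rw [← sum_map_first]
  simp only [Fin.getElem_fin]
  exact List.sum_ofFn.symm.trans
    (congrArg List.sum (List.ofFn_getElem_eq_map T fun t => if t.first = true then 1 else 0))

/-- Non-opening clause tokens open nothing. [folklore] -/
theorem countP_first_clauseTokens_false : ∀ c : Clause α,
    (clauseTokens false c).countP (fun t => t.first) = 0
  | [] => rfl
  | _ :: c => by
    rw [clauseTokens, List.countP_cons_of_neg (by simp)]
    exact countP_first_clauseTokens_false c

/-- **The clause-opening tokens of a CNF count its nonempty clauses.** [folklore] -/
theorem firstCount_tokens : ∀ φ : CNF α, firstCount (tokens φ) = nonemptyCount φ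
  | [] => by simp [firstCount_eq_countP, tokens, nonemptyCount]
  | [] :: φ => by
    have h1 : tokens ([] :: φ) = tokens φ := by simp [tokens, clauseTokens]
    have h2 : nonemptyCount (α := α) ([] :: φ) = nonemptyCount φ := by simp [nonemptyCount]
    rw [h1, h2]
    exact firstCount_tokens φ
  | (l :: c) :: φ => by
    have ht : tokens ((l :: c) :: φ) = ⟨l.1, l.2, true⟩ :: (clauseTokens false c ++ tokens φ) := by
      simp [tokens, clauseTokens]
    have h2 : nonemptyCount ((l :: c) :: φ) = nonemptyCount φ + 1 := by simp [nonemptyCount]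
    rw [firstCount_eq_countP, ht, List.countP_cons_of_pos (by simp), List.countP_append,
      countP_first_clauseTokens_false, zero_add, ← firstCount_eq_countP, firstCount_tokens φ, h2]

variable [DecidableEq α]

/-- **The energy threshold of a CNF**: `K_φ = -(P + L + m)` with `P` the number of pairs of
occurrences of the same variable, `L` the number of literal occurrences and `m` the number of
clauses (empty clauses included, which makes `K_φ` unattainable for them). [folklore] -/
def threshold (φ : CNF α) : ℤ :=
  -((pairCount (tokens φ) + (tokens φ).length + φ.length : ℕ) : ℤ)

/-- The threshold is minus the number of units minus the number of empty clauses. [folklore] -/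
theorem threshold_eq (φ : CNF α) :
    threshold φ = -(units (tokens φ) : ℤ) - ((φ.length - nonemptyCount φ : ℕ) : ℤ) := by
  unfold threshold units
  rw [firstCount_tokens, Nat.cast_sub (nonemptyCount_le φ)]
  push_cast
  ring

/-- **Main theorem of the gadget: `J_φ` has a configuration of energy `≤ K_φ` iff `φ` is
satisfiable.** [folklore] -/
theorem exists_energy_le_threshold_iff (φ : CNF α) :
    (∃ σ, isingEnergy (J (tokens φ)) σ ≤ threshold φ) ↔ φ.Satisfiable := by
  rw [threshold_eq, exists_energy_le_iff, satisfiable_iff_tsat, Nat.sub_eq_zero_iff_le,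
    ← nonemptyCount_eq_length_iff]
  have := nonemptyCount_le φ
  constructor
  · rintro ⟨h, h'⟩; exact ⟨le_antisymm this h, h'⟩
  · rintro ⟨h, h'⟩; exact ⟨h.ge, h'⟩

/-- The instance has unit couplings. [folklore] -/
theorem isUnitCoupling_tokens (φ : CNF α) : IsUnitCoupling (J (tokens φ)) :=
  isUnitCoupling_J _

end CNFInterface

end CNFIsing

end Literature.Barriers.HubbardSuperconductivity
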